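import Summits.AtomisticToContinuum.Crystallization.Theorems.PhononSlackCertificatesPeriodicGivenLayeredClosing3
import Summits.AtomisticToContinuum.Crystallization.Theorems.PhononSlackCertificatesPeriodicGivenLayeredWindowBounds
import Summits.AtomisticToContinuum.Crystallization.Theorems.PhononSlackCertificatesPeriodicGivenLayeredRegistry
import Summits.AtomisticToContinuum.Crystallization.Theorems.PhononSlackCertificatesPeriodicGivenLayeredLayerCake

/-!
# `stub_uniformSpacing` (crux `GapTwelveToBarlow`, stmt-AtomisticToContinuum-15807), energetic side, I:
# a QUANTITATIVE fault bound in the hull (density upgrade of `LayeredHull.clo_partA` of stmt-11779)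

Helper for the residual of `stub_uniformSpacing` (see `stub_uniformSpacing.lean`,
`uniformSpacing-REPORT.md`).  `LayeredHull.clo_partA` (line `Sketch` of `PeriodicGivenLayered`,
stmt-11779, landed) shows that a UNIFORMLY RECURRENT layered set in the hull of a sequence of
Lennard-Jones ground states has no stacking fault.  Its proof in fact gives, WITHOUT recurrence, a
uniform bound: the per-layer registry price `clo_layer_price` (`≥ c₀` per faulted layer, same heights,
alternating comparison word), the layer cake on the prisms `W(m₁, n, K)` and the window bounds (U)/(L)
at equal cardinality `n K²` give `c₀ K² · #faults(m₁, n) ≤ (|C_U| + |C_L|)·C·(nK + K²)`, i.e. with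
`K = n`: **every block of consecutive layers of every layered hull element of every ground-state
sequence contains at most `F₀ = 2 (|C_U| + |C_L|) C / c₀` stacking faults** (`hull_faultCount_le`),
with `F₀` depending only on the universal constants of `stub_windowBounds`, `stub_registry`,
`stub_layerCake`; the fully discharged form is `hull_faultCount_le_of_landed`.

This is the word half of "a.e. near-uniform gaps" at the hull level; the increment half
(`clo_partB`) is landed only for globally fault-free words, and the passage hull ⇒ a.e. (positive
density of bad windows ⇒ a hull element with `> F₀` faults in a block) is not formalised.
-/

noncomputable section

namespace Summit.AtomisticToContinuum.Crystallization.Theorems.SquareWellLayerCakeGapTwelveToBarlow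

open scoped BigOperators
open Filter Literature.MathematicalPhysics.StatisticalMechanics
open Summit.AtomisticToContinuum.Crystallization.Theorems.LayeredHull

/-- **Quantitative fault bound in the hull.**  Given the window bounds (U), (L), the registry facts
and the layer cake (hypotheses verbatim as in `LayeredHull.stub_closing`), there is `F₀` such that for
every sequence `x` of Lennard-Jones ground states and every layered set `A(S(a, s, z))` in the hull of
`x` (`a ∈ [47/50, 1]`, `IsHaggSeq s`, increments in the box), every block `[m₁, m₁ + n)` of layers
contains at most `F₀` stacking faults (`s (m+1) ≠ -s m`).  No recurrence hypothesis. -/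
theorem hull_faultCount_le
    (hU : ∃ C : ℝ, ∀ x : (N : ℕ) → (Fin N → (EuclideanSpace ℝ (Fin 3))), (∀ N, IsGroundState lennardJones (x N)) →
      ∀ S : Set (EuclideanSpace ℝ (Fin 3)), (∀ R ε : ℝ, 0 < ε → ∃ᶠ N in atTop, ∃ t : (EuclideanSpace ℝ (Fin 3)),
        (∀ p ∈ S, ‖p‖ ≤ R → ∃ i : Fin N, dist (x N i + t) p ≤ ε) ∧
        (∀ i : Fin N, ‖x N i + t‖ ≤ R → ∃ p ∈ S, dist (x N i + t) p ≤ ε)) →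
      ∀ W : Finset (EuclideanSpace ℝ (Fin 3)), (↑W : Set (EuclideanSpace ℝ (Fin 3))) ⊆ S →
        ∑ p ∈ W, (∑' q : {q : (EuclideanSpace ℝ (Fin 3)) // q ∈ S ∧ q ≠ p}, lennardJones (dist p (q : (EuclideanSpace ℝ (Fin 3))))) ≤
          2 * groundStateEnergy lennardJones 3 W.card +
            C * ∑ p ∈ W, (1 + Metric.infDist p (S \ (↑W : Set (EuclideanSpace ℝ (Fin 3)))))⁻¹ ^ 3)
    (hL : ∀ δ : ℝ, 0 < δ → ∃ C : ℝ, ∀ S : Set (EuclideanSpace ℝ (Fin 3)), (∀ p ∈ S, ∀ q ∈ S, p ≠ q → δ ≤ dist p q) →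
      ∀ W : Finset (EuclideanSpace ℝ (Fin 3)), (↑W : Set (EuclideanSpace ℝ (Fin 3))) ⊆ S →
        2 * groundStateEnergy lennardJones 3 W.card -
            C * ∑ p ∈ W, (1 + Metric.infDist p (S \ (↑W : Set (EuclideanSpace ℝ (Fin 3)))))⁻¹ ^ 3 ≤
          ∑ p ∈ W, (∑' q : {q : (EuclideanSpace ℝ (Fin 3)) // q ∈ S ∧ q ≠ p}, lennardJones (dist p (q : (EuclideanSpace ℝ (Fin 3))))))
    (hreg : ∃ c₀ : ℝ, 0 < c₀ ∧ ∀ a : ℝ, 47 / 50 ≤ a → a ≤ 1 →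
      (∀ H H' : ℝ, 39 / 25 * a ≤ H → H ≤ H' →
        barlowCoupling lennardJones a H' 1 ≤ 0 ∧
          barlowCoupling lennardJones a H 1 ≤ barlowCoupling lennardJones a H' 1) ∧
      c₀ ≤ barlowCoupling lennardJones a (117 / 50 * a) 1 - barlowCoupling lennardJones a (17 / 10 * a) 1)
    (hcake : ∃ C : ℝ, ∀ a : ℝ, 47 / 50 ≤ a → a ≤ 1 →
      (∀ (H : ℝ) (δ : ℤ), 7 / 10 ≤ |H| → |layerInteraction lennardJones a H δ 1| ≤ C / H ^ 4) ∧
      ∀ (A : (EuclideanSpace ℝ (Fin 3)) →ₗᵢ[ℝ] (EuclideanSpace ℝ (Fin 3))) (s : ℤ → ℤ) (z : ℤ → ℝ), IsHaggSeq s →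
        (∀ m : ℤ, 39 / 50 * a ≤ z (m + 1) - z m ∧ z (m + 1) - z m ≤ 17 / 20 * a) →
        let S : Set (EuclideanSpace ℝ (Fin 3)) := {p | ∃ m i j : ℤ, p = A (((i : ℝ) • triangularVec₁ a) +
          ((j : ℝ) • triangularVec₂ a) + ((haggLabel s m : ℝ) • barlowOffset a) + (z m • layerNormal 1))};
        (∀ p ∈ S, ∀ q ∈ S, p ≠ q → 1 / 2 ≤ dist p q) ∧
        (∀ m : ℤ, Summable fun m' : ℤ => if m' = m then (0 : ℝ) else
          layerInteraction lennardJones a (z m' - z m) (haggLabel s m' - haggLabel s m) 1) ∧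
        (∀ m i j : ℤ,
          (∑' q : {q : (EuclideanSpace ℝ (Fin 3)) // q ∈ S ∧ q ≠ A (((i : ℝ) • triangularVec₁ a) + ((j : ℝ) • triangularVec₂ a) +
              ((haggLabel s m : ℝ) • barlowOffset a) + (z m • layerNormal 1))},
            lennardJones (dist (A (((i : ℝ) • triangularVec₁ a) + ((j : ℝ) • triangularVec₂ a) +
              ((haggLabel s m : ℝ) • barlowOffset a) + (z m • layerNormal 1))) (q : (EuclideanSpace ℝ (Fin 3))))) =
          inLayerInteraction lennardJones a + ∑' m' : ℤ, if m' = m then (0 : ℝ) else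
            layerInteraction lennardJones a (z m' - z m) (haggLabel s m' - haggLabel s m) 1) ∧
        (∀ (m₁ : ℤ) (n K : ℕ),
          let W : Finset (EuclideanSpace ℝ (Fin 3)) := ((Finset.Ico m₁ (m₁ + n)) ×ˢ ((Finset.range K) ×ˢ (Finset.range K))).image
            fun t : ℤ × (ℕ × ℕ) => A (((((t.2.1 : ℤ) - haggLabel s t.1 / 3 : ℤ) : ℝ) • triangularVec₁ a) +
              ((((t.2.2 : ℤ) - haggLabel s t.1 / 3 : ℤ) : ℝ) • triangularVec₂ a) +
              ((haggLabel s t.1 : ℝ) • barlowOffset a) + (z t.1 • layerNormal 1));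
          (↑W : Set (EuclideanSpace ℝ (Fin 3))) ⊆ S ∧ W.card = n * K ^ 2 ∧
          (∑ p ∈ W, (∑' q : {q : (EuclideanSpace ℝ (Fin 3)) // q ∈ S ∧ q ≠ p}, lennardJones (dist p (q : (EuclideanSpace ℝ (Fin 3)))))) =
            (K : ℝ) ^ 2 * ∑ m ∈ Finset.Ico m₁ (m₁ + n), (inLayerInteraction lennardJones a +
              ∑' m' : ℤ, if m' = m then (0 : ℝ) else
                layerInteraction lennardJones a (z m' - z m) (haggLabel s m' - haggLabel s m) 1) ∧
          (∑ p ∈ W, (1 + Metric.infDist p (S \ (↑W : Set (EuclideanSpace ℝ (Fin 3)))))⁻¹ ^ 3) ≤ C * (n * K + K ^ 2))) :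
    ∃ F₀ : ℝ, ∀ (x : (N : ℕ) → (Fin N → (EuclideanSpace ℝ (Fin 3)))), (∀ N, IsGroundState lennardJones (x N)) →
      ∀ (a : ℝ), 47 / 50 ≤ a → a ≤ 1 →
      ∀ (A : (EuclideanSpace ℝ (Fin 3)) →ₗᵢ[ℝ] (EuclideanSpace ℝ (Fin 3))) (s : ℤ → ℤ) (z : ℤ → ℝ),
      IsHaggSeq s → (∀ m : ℤ, 39 / 50 * a ≤ z (m + 1) - z m ∧ z (m + 1) - z m ≤ 17 / 20 * a) →
      (let S : Set (EuclideanSpace ℝ (Fin 3)) := {p | ∃ m i j : ℤ, p = A (((i : ℝ) • triangularVec₁ a) +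
          ((j : ℝ) • triangularVec₂ a) + ((haggLabel s m : ℝ) • barlowOffset a) + (z m • layerNormal 1))};
        ∀ R ε : ℝ, 0 < ε → ∃ᶠ N in atTop, ∃ t : (EuclideanSpace ℝ (Fin 3)),
          (∀ p ∈ S, ‖p‖ ≤ R → ∃ i : Fin N, dist (x N i + t) p ≤ ε) ∧
          (∀ i : Fin N, ‖x N i + t‖ ≤ R → ∃ p ∈ S, dist (x N i + t) p ≤ ε)) →
      ∀ (m₁ : ℤ) (n : ℕ),
        (∑ m ∈ Finset.Ico m₁ (m₁ + n), (if s (m + 1) = -s m then (0 : ℝ) else 1)) ≤ F₀ := by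
  classical
  -- unpack the universal constants
  obtain ⟨CU, hU'⟩ := hU
  obtain ⟨CL, hL'⟩ := hL (1 / 2) (by norm_num)
  obtain ⟨c₀, hc₀, hreg'⟩ := hreg
  obtain ⟨Cc, hcake'⟩ := hcake
  refine ⟨2 * ((|CU| + |CL|) * Cc) / c₀, ?_⟩
  intro x hx a ha ha1 A s z hs hz hH m₁ n
  obtain ⟨hreg1, hreg2⟩ := hreg' a ha ha1
  obtain ⟨hdecay, hcakeA⟩ := hcake' a ha ha1
  obtain ⟨-, hsumS, -, hprismS⟩ := hcakeA A s z hs hz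
  obtain ⟨hsepA, hsumA, -, hprismA⟩ := hcakeA A alternatingHagg z isHaggSeq_alternating hz
  have hCc : 0 ≤ Cc := by
    have h1 := hdecay 1 0 (by norm_num)
    have : (0 : ℝ) ≤ Cc / 1 ^ 4 := (abs_nonneg _).trans h1
    simpa using this
  -- the trivial block
  rcases Nat.eq_zero_or_pos n with rfl | hnpos
  · simp only [Nat.cast_zero, add_zero, Finset.Ico_self, Finset.sum_empty]
    positivity
  have hKpos : (0 : ℝ) < (n : ℝ) := by exact_mod_cast hnpos
  -- the two prisms (`n` layers from `m₁`, `K = n` columns squared)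
  obtain ⟨hWsub, hWcard, hWsum, hWbd⟩ := hprismS m₁ n n
  obtain ⟨hW'sub, hW'card, hW'sum, hW'bd⟩ := hprismA m₁ n n
  -- (U) for `W ⊆ S` (in the hull) and (L) for `W' ⊆ S'` (`1/2`-separated), same cardinality
  have hUw := hU' x hx _ hH _ hWsub
  have hLw := hL' _ hsepA _ hW'sub
  rw [hWcard, hWsum] at hUw
  rw [hW'card, hW'sum] at hLw
  have hUw' := clo_absorb_upper hUw hWbd (Finset.sum_nonneg fun p _ =>
    pow_nonneg (inv_nonneg.2 (add_nonneg zero_le_one Metric.infDist_nonneg)) 3)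
  have hLw' := clo_absorb_lower hLw hW'bd (Finset.sum_nonneg fun p _ =>
    pow_nonneg (inv_nonneg.2 (add_nonneg zero_le_one Metric.infDist_nonneg)) 3)
  -- per-layer price, summed over the block
  have hprice : ∀ m : ℤ, c₀ * (if s (m + 1) = -s m then (0 : ℝ) else 1) ≤
      (∑' m' : ℤ, if m' = m then (0 : ℝ) else
          layerInteraction lennardJones a (z m' - z m) (haggLabel s m' - haggLabel s m) 1) -
      (∑' m' : ℤ, if m' = m then (0 : ℝ) else
          layerInteraction lennardJones a (z m' - z m)
            (haggLabel alternatingHagg m' - haggLabel alternatingHagg m) 1) := fun m =>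
    clo_layer_price ha hs hz hdecay hreg1 hreg2 m (hsumS m) (hsumA m)
  have hsum_price : c₀ * ∑ m ∈ Finset.Ico m₁ (m₁ + n),
      (if s (m + 1) = -s m then (0 : ℝ) else 1) ≤
      (∑ m ∈ Finset.Ico m₁ (m₁ + n), (inLayerInteraction lennardJones a +
        (∑' m' : ℤ, if m' = m then (0 : ℝ) else
          layerInteraction lennardJones a (z m' - z m) (haggLabel s m' - haggLabel s m) 1))) -
      ∑ m ∈ Finset.Ico m₁ (m₁ + n), (inLayerInteraction lennardJones a +
        (∑' m' : ℤ, if m' = m then (0 : ℝ) else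
          layerInteraction lennardJones a (z m' - z m)
            (haggLabel alternatingHagg m' - haggLabel alternatingHagg m) 1)) := by
    rw [Finset.mul_sum, ← Finset.sum_sub_distrib]
    refine Finset.sum_le_sum fun m _ => ?_
    have := hprice m
    linarith
  set F : ℝ := ∑ m ∈ Finset.Ico m₁ (m₁ + n), (if s (m + 1) = -s m then (0 : ℝ) else 1) with hF
  -- the energy inequality `K² · c₀ F ≤ (|CU| + |CL|) Cc (nK + K²)` with `K = n`
  have hmain : (n : ℝ) ^ 2 * (c₀ * F) ≤
      (|CU| + |CL|) * (Cc * ((n : ℝ) * (n : ℝ) + (n : ℝ) ^ 2)) := by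
    have h2 := mul_le_mul_of_nonneg_left hsum_price (show (0 : ℝ) ≤ (n : ℝ) ^ 2 by positivity)
    nlinarith [h2, hUw', hLw', abs_nonneg CU, abs_nonneg CL]
  -- divide by `K² > 0`
  have hK2 : (0 : ℝ) < (n : ℝ) ^ 2 := by positivity
  have hdiv : c₀ * F ≤ 2 * ((|CU| + |CL|) * Cc) := by
    have e : (|CU| + |CL|) * (Cc * ((n : ℝ) * (n : ℝ) + (n : ℝ) ^ 2)) =
        (n : ℝ) ^ 2 * (2 * ((|CU| + |CL|) * Cc)) := by ring
    rw [e] at hmain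
    exact le_of_mul_le_mul_left hmain hK2
  rw [le_div_iff₀ hc₀]
  linarith

/-- **Quantitative fault bound in the hull, discharged** by the landed stubs of stmt-11779
(`stub_windowBounds`, `stub_registry`, `stub_layerCake`): there is a universal `F₀` such that every
block of consecutive layers of every layered set in the hull of any sequence of Lennard-Jones ground
states has at most `F₀` stacking faults. -/
theorem hull_faultCount_le_of_landed :
    ∃ F₀ : ℝ, ∀ (x : (N : ℕ) → (Fin N → (EuclideanSpace ℝ (Fin 3)))), (∀ N, IsGroundState lennardJones (x N)) →
      ∀ (a : ℝ), 47 / 50 ≤ a → a ≤ 1 →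
      ∀ (A : (EuclideanSpace ℝ (Fin 3)) →ₗᵢ[ℝ] (EuclideanSpace ℝ (Fin 3))) (s : ℤ → ℤ) (z : ℤ → ℝ),
      IsHaggSeq s → (∀ m : ℤ, 39 / 50 * a ≤ z (m + 1) - z m ∧ z (m + 1) - z m ≤ 17 / 20 * a) →
      (let S : Set (EuclideanSpace ℝ (Fin 3)) := {p | ∃ m i j : ℤ, p = A (((i : ℝ) • triangularVec₁ a) +
          ((j : ℝ) • triangularVec₂ a) + ((haggLabel s m : ℝ) • barlowOffset a) + (z m • layerNormal 1))};
        ∀ R ε : ℝ, 0 < ε → ∃ᶠ N in atTop, ∃ t : (EuclideanSpace ℝ (Fin 3)),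
          (∀ p ∈ S, ‖p‖ ≤ R → ∃ i : Fin N, dist (x N i + t) p ≤ ε) ∧
          (∀ i : Fin N, ‖x N i + t‖ ≤ R → ∃ p ∈ S, dist (x N i + t) p ≤ ε)) →
      ∀ (m₁ : ℤ) (n : ℕ),
        (∑ m ∈ Finset.Ico m₁ (m₁ + n), (if s (m + 1) = -s m then (0 : ℝ) else 1)) ≤ F₀ :=
  hull_faultCount_le stub_windowBounds.1 stub_windowBounds.2 stub_registry stub_layerCake


/-- Registered sub-goal form of `hull_faultCount_le_of_landed` (same statement): every layered
hull element of a Lennard-Jones ground-state sequence has at most `F₀` stacking faults in any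
block of layers — the hull-level part of `stub_uniformSpacing`. [folklore] -/
theorem stub_hullFaultCount :
    ∃ F₀ : ℝ, ∀ (x : (N : ℕ) → (Fin N → (EuclideanSpace ℝ (Fin 3)))), (∀ N, IsGroundState lennardJones (x N)) →
      ∀ (a : ℝ), 47 / 50 ≤ a → a ≤ 1 →
      ∀ (A : (EuclideanSpace ℝ (Fin 3)) →ₗᵢ[ℝ] (EuclideanSpace ℝ (Fin 3))) (s : ℤ → ℤ) (z : ℤ → ℝ),
      IsHaggSeq s → (∀ m : ℤ, 39 / 50 * a ≤ z (m + 1) - z m ∧ z (m + 1) - z m ≤ 17 / 20 * a) →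
      (let S : Set (EuclideanSpace ℝ (Fin 3)) := {p | ∃ m i j : ℤ, p = A (((i : ℝ) • triangularVec₁ a) +
          ((j : ℝ) • triangularVec₂ a) + ((haggLabel s m : ℝ) • barlowOffset a) + (z m • layerNormal 1))};
        ∀ R ε : ℝ, 0 < ε → ∃ᶠ N in atTop, ∃ t : (EuclideanSpace ℝ (Fin 3)),
          (∀ p ∈ S, ‖p‖ ≤ R → ∃ i : Fin N, dist (x N i + t) p ≤ ε) ∧
          (∀ i : Fin N, ‖x N i + t‖ ≤ R → ∃ p ∈ S, dist (x N i + t) p ≤ ε)) →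
      ∀ (m₁ : ℤ) (n : ℕ),
        (∑ m ∈ Finset.Ico m₁ (m₁ + n), (if s (m + 1) = -s m then (0 : ℝ) else 1)) ≤ F₀ :=
  hull_faultCount_le_of_landed

end Summit.AtomisticToContinuum.Crystallization.Theorems.SquareWellLayerCakeGapTwelveToBarlow

end
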